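import Literature.MathematicalPhysics.QuantumLattice.AnisotropicBandFermiCurveBranches
import Literature.MathematicalPhysics.QuantumLattice.KohnLuttingerLindhardMeasurable
import HarnessLib

/-!
# The density-of-states measure of the anisotropic band `-2(a cos k₀ + b cos k₁)` as a
# one-dimensional integral

Step A of the s-representation of the square-lattice Lindhard function (cell `gate-hubbard-kl`,
item stmt-HubbardSuperconductivity-19294 `LindhardPointwiseIdentification`, CERT-SREP §1 Prop. 1–2):
for every `a`, every `b > 0` and every level `μ`,

  `fermiCurveMeasure (k ↦ -2(a cos k₀ + b cos k₁)) μ univ = ∫⁻ x in Ico (-π) π, 2/√(4b² - (μ + 2a cos x)²)`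

(`ENNReal.ofReal`, so the integrand vanishes where `|μ + 2a cos x| ≥ 2b`): the total mass of the
`‖∇ε‖⁻¹`-weighted arc-length measure of the level curve `{a cos k₀ + b cos k₁ = -μ/2} ∩ [-π,π)²` is
the integral over the first coordinate of the one-dimensional density of states
`Σ_{y ∈ [-π,π), -2b cos y = E} 1/|2b sin y| = 2/√(4b² - E²)` of `-2b cos` at `E = μ + 2a cos x`
(the classical "2-D DOS = convolution of the two 1-D DOS" for a separable band; both sides are `∞`
exactly at the van Hove levels `μ = ±2(a - b)`). Proof: the level curve is, off the lines
`k₁ ∈ {0, -π}`, the disjoint union of the two graph branches of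
`AnisotropicBandFermiCurveBranches.lean` (`fermiCurve_anisoBand_inter_eq_image`); on each branch the
area formula gives the integrand `1/√(4b² - (μ + 2a cos x)²)`; the leftover is countable (`a ≠ 0`,
`μH[1]`-null) or carries density `‖∇ε‖⁻¹ = 0⁻¹ = 0` (`a = 0`); outside `{|h| < 1}` the integrand is
`2/√(nonpositive) = 0`. Theorems only.

## References
* H. Federer, *Geometric Measure Theory* (1969) 3.2.3, 3.2.5 (area formula) [Federer1969].
* S. Raghu, S. A. Kivelson, D. J. Scalapino, Phys. Rev. B 81 (2010) 224505, §II (6) (DOS measure)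
  [RaghuKivelsonScalapino2010].
-/

noncomputable section

open Real Set MeasureTheory MeasureTheory.Measure
open scoped Topology ENNReal RealInnerProductSpace

namespace Literature.MathematicalPhysics.QuantumLattice

/-! ### The level curve as the union of the two graph branches -/

/-- The Brillouin zone is a measurable set (Literature-side copy of the 5-line fact proved in
`Summits/…/WeakCouplingBCSWcbcsKohnLuttingerB1gReduction.lean`, which Literature cannot import).
[cite: RaghuKivelsonScalapino2010, §II (6)] -/
theorem brillouinZone_measurableSet : MeasurableSet brillouinZone := by
  have : brillouinZone = ⋂ i : Fin 2, (fun k : Momentum => k i) ⁻¹' Set.Ico (-Real.pi) Real.pi := by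
    ext k; simp [brillouinZone]
  rw [this]
  refine MeasurableSet.iInter fun i => ?_
  exact measurableSet_Ico.preimage (by fun_prop)

/-- The Fermi curve of a measurable band is measurable. [cite: RaghuKivelsonScalapino2010, §II (6)] -/
theorem fermiCurve_measurableSet {ε : Momentum → ℝ} (hε : Measurable ε) (μ : ℝ) :
    MeasurableSet (fermiCurve ε μ) :=
  brillouinZone_measurableSet.inter (hε (measurableSet_singleton μ))

section Pieces

variable {a b μ : ℝ}

/-- **The branch pieces of the level curve**: for `b ≠ 0` and `ς = ±1`, the part of the Fermi curve
of the anisotropic band with `ς k₁ ∈ (0, π)` is exactly the image of `[-π,π) ∩ {|h| < 1}` under the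
graph branch `γ_ς`. [cite: RaghuKivelsonScalapino2010, §II (6)] -/
theorem fermiCurve_anisoBand_inter_eq_image (a b μ ς : ℝ) (hb : b ≠ 0) (hς : ς = 1 ∨ ς = -1) :
    fermiCurve (fun k : Momentum => -2 * (a * Real.cos (k 0) + b * Real.cos (k 1))) μ ∩
        {k : Momentum | ς * k 1 ∈ Ioo (0 : ℝ) π} =
      (fun x : ℝ => (WithLp.toLp 2 ![x, ς * Real.arccos (-(μ + 2 * a * Real.cos x) / (2 * b))] : Momentum)) ''
        (Ico (-π) π ∩ {x : ℝ | -(μ + 2 * a * Real.cos x) / (2 * b) ∈ Ioo (-1 : ℝ) 1}) := by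
  have hς2 : ς * ς = 1 := by rcases hς with rfl | rfl <;> norm_num
  have hcosς : ∀ t : ℝ, Real.cos (ς * t) = Real.cos t := fun t => by
    rcases hς with rfl | rfl
    · rw [one_mul]
    · rw [neg_one_mul, Real.cos_neg]
  have habsς : |ς| = 1 := by rcases hς with rfl | rfl <;> norm_num
  ext k
  simp only [mem_inter_iff, mem_setOf_eq, mem_image, fermiCurve, brillouinZone]
  constructor
  · rintro ⟨⟨hBZ, hlev⟩, ht⟩
    set t := ς * k 1 with htdef
    have hk1 : k 1 = ς * t := by rw [htdef, ← mul_assoc, hς2, one_mul]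
    have hcos : Real.cos (k 1) = -(μ + 2 * a * Real.cos (k 0)) / (2 * b) := by
      field_simp
      linarith
    have hcost : Real.cos t = -(μ + 2 * a * Real.cos (k 0)) / (2 * b) := by
      rw [htdef, hcosς, hcos]
    refine ⟨k 0, ⟨hBZ 0, ?_⟩, ?_⟩
    · rw [← hcost]
      constructor
      · -- `-1 < cos t` for `t ∈ (0, π)`
        have := Real.cos_lt_cos_of_nonneg_of_le_pi ht.1.le le_rfl ht.2
        rwa [Real.cos_pi] at this
      · have := Real.cos_lt_cos_of_nonneg_of_le_pi le_rfl ht.2.le ht.1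
        rwa [Real.cos_zero] at this
    · have harc : Real.arccos (-(μ + 2 * a * Real.cos (k 0)) / (2 * b)) = t := by
        rw [← hcost, Real.arccos_cos ht.1.le ht.2.le]
      ext i
      fin_cases i
      · simp
      · simp only [Fin.mk_one, Matrix.cons_val_one, Matrix.cons_val_zero]
        rw [harc, hk1]
  · rintro ⟨x, ⟨hx, hU⟩, rfl⟩
    have harc0 : 0 < Real.arccos (-(μ + 2 * a * Real.cos x) / (2 * b)) := Real.arccos_pos.2 hU.2
    have harcπ : Real.arccos (-(μ + 2 * a * Real.cos x) / (2 * b)) < π := Real.arccos_lt_pi.2 hU.1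
    refine ⟨⟨fun i => ?_, ?_⟩, ?_⟩
    · fin_cases i
      · simpa using hx
      · simp only [Fin.mk_one, Matrix.cons_val_one, Matrix.cons_val_zero, mem_Ico]
        have : |ς * Real.arccos (-(μ + 2 * a * Real.cos x) / (2 * b))| < π := by
          rw [abs_mul, habsς, one_mul, abs_of_pos harc0]; exact harcπ
        rw [abs_lt] at this
        exact ⟨this.1.le, this.2⟩
    · simp only [Matrix.cons_val_zero, Matrix.cons_val_one]
      rw [hcosς, Real.cos_arccos hU.1.le hU.2.le]
      field_simp
      ring
    · simp only [Matrix.cons_val_one, Matrix.cons_val_zero]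
      rw [← mul_assoc, hς2, one_mul]
      exact ⟨harc0, harcπ⟩

/-- The leftover of the level curve off the two branch pieces lies on the two lines `k₁ ∈ {0, -π}`.
[cite: RaghuKivelsonScalapino2010, §II (6)] -/
theorem fermiCurve_anisoBand_diff_subset (a b μ : ℝ) :
    (fermiCurve (fun k : Momentum => -2 * (a * Real.cos (k 0) + b * Real.cos (k 1))) μ \
        {k : Momentum | (1 : ℝ) * k 1 ∈ Ioo (0 : ℝ) π}) \ {k : Momentum | (-1 : ℝ) * k 1 ∈ Ioo (0 : ℝ) π} ⊆
      {k : Momentum | k ∈ fermiCurve (fun k : Momentum => -2 * (a * Real.cos (k 0) + b * Real.cos (k 1))) μ ∧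
        (k 1 = 0 ∨ k 1 = -π)} := by
  rintro k ⟨⟨hF, h1⟩, h2⟩
  refine ⟨hF, ?_⟩
  simp only [mem_setOf_eq, one_mul, neg_one_mul, mem_Ioo, not_and, not_lt] at h1 h2
  have hk := hF.1 1
  rcases lt_trichotomy (k 1) 0 with hlt | heq | hgt
  · right
    have : π ≤ -k 1 := h2 (by linarith)
    linarith [hk.1]
  · exact Or.inl heq
  · have : π ≤ k 1 := h1 hgt
    linarith [hk.2]

end Pieces

/-! ### Step A: the total mass of the density-of-states measure -/

/-- **The density-of-states measure of the anisotropic band as a one-dimensional integral.**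
For every `a`, every `b > 0` and every level `μ`,
`fermiCurveMeasure (k ↦ -2(a cos k₀ + b cos k₁)) μ univ = ∫⁻_{x ∈ [-π,π)} 2/√(4b² - (μ + 2a cos x)²) dx`
(`ENNReal.ofReal`; the integrand is the one-dimensional density of states
`Σ_{y ∈ [-π,π), -2b cos y = E} 1/|2b sin y|` of the band `-2b cos` at `E = μ + 2a cos x`, and vanishes
for `|E| ≥ 2b`). Both sides may be `∞` (at the van Hove levels `μ = ±2(a - b)`).
[cite: RaghuKivelsonScalapino2010, §II (6)] -/
theorem fermiCurveMeasure_anisoBand_univ (a b μ : ℝ) (hb : 0 < b) :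
    fermiCurveMeasure (fun k : Momentum => -2 * (a * Real.cos (k 0) + b * Real.cos (k 1))) μ univ =
      ∫⁻ x in Ico (-π) π, ENNReal.ofReal (2 / Real.sqrt (4 * b ^ 2 - (μ + 2 * a * Real.cos x) ^ 2)) := by
  have hb0 : b ≠ 0 := hb.ne'
  set U : Set ℝ := {x : ℝ | -(μ + 2 * a * Real.cos x) / (2 * b) ∈ Ioo (-1 : ℝ) 1} with hU
  set T : Set ℝ := Ico (-π) π ∩ U with hT
  set Bp : Set Momentum := {k : Momentum | (1 : ℝ) * k 1 ∈ Ioo (0 : ℝ) π} with hBp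
  set Bm : Set Momentum := {k : Momentum | (-1 : ℝ) * k 1 ∈ Ioo (0 : ℝ) π} with hBm
  have hem : Measurable (fun k : Momentum => -2 * (a * Real.cos (k 0) + b * Real.cos (k 1))) :=
    (continuous_anisoBand a b).measurable
  have hwm := measurable_invSpeed_anisoBand a b
  have hFm := fermiCurve_measurableSet hem μ
  have hUo : IsOpen U := isOpen_anisoBranchDom a b μ
  have hTm : MeasurableSet T := measurableSet_Ico.inter hUo.measurableSet
  have hTU : T ⊆ U := inter_subset_right
  have hk1m : Measurable fun k : Momentum => k 1 := (PiLp.continuous_apply 2 _ (1 : Fin 2)).measurable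
  have hBpm : MeasurableSet Bp := measurableSet_Ioo.preimage (measurable_const.mul hk1m)
  have hBmm : MeasurableSet Bm := measurableSet_Ioo.preimage (measurable_const.mul hk1m)
  -- Step 0: total mass as an integral over the level curve
  have h0 : fermiCurveMeasure (fun k : Momentum => -2 * (a * Real.cos (k 0) + b * Real.cos (k 1))) μ univ =
      ∫⁻ k in fermiCurve (fun k : Momentum => -2 * (a * Real.cos (k 0) + b * Real.cos (k 1))) μ,
        ENNReal.ofReal (‖gradient (fun k : Momentum => -2 * (a * Real.cos (k 0) + b * Real.cos (k 1))) k‖⁻¹)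
          ∂(μH[1] : Measure Momentum) := by
    simp only [fermiCurveMeasure, withDensity_apply _ MeasurableSet.univ, Measure.restrict_univ]
  -- the two branch pieces
  have hP : ∀ ς : ℝ, ς = 1 ∨ ς = -1 →
      ∫⁻ k in fermiCurve (fun k : Momentum => -2 * (a * Real.cos (k 0) + b * Real.cos (k 1))) μ ∩
          {k : Momentum | ς * k 1 ∈ Ioo (0 : ℝ) π},
        ENNReal.ofReal (‖gradient (fun k : Momentum => -2 * (a * Real.cos (k 0) + b * Real.cos (k 1))) k‖⁻¹)
          ∂(μH[1] : Measure Momentum) =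
      ∫⁻ x in T, ENNReal.ofReal (1 / Real.sqrt (4 * b ^ 2 - (μ + 2 * a * Real.cos x) ^ 2)) := by
    intro ς hς
    rw [fermiCurve_anisoBand_inter_eq_image a b μ ς hb0 hς, lintegral_image_anisoBranch a b μ ς hb0 hTm hTU hwm]
    exact setLIntegral_congr_fun hTm fun x hx => anisoBranch_density a b μ ς x hb hς (hTU hx)
  -- the leftover on the lines `k₁ ∈ {0, -π}`
  have hL : ∫⁻ k in (fermiCurve (fun k : Momentum => -2 * (a * Real.cos (k 0) + b * Real.cos (k 1))) μ \ Bp) \ Bm,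
        ENNReal.ofReal (‖gradient (fun k : Momentum => -2 * (a * Real.cos (k 0) + b * Real.cos (k 1))) k‖⁻¹)
          ∂(μH[1] : Measure Momentum) = 0 := by
    rcases eq_or_ne a 0 with rfl | ha0
    · -- `a = 0`: the density vanishes on the leftover (`∇ε = 0` there)
      refine setLIntegral_eq_zero ((hFm.diff hBpm).diff hBmm) fun k hk => ?_
      have hk' := fermiCurve_anisoBand_diff_subset 0 b μ hk
      have hsin : Real.sin (k 1) = 0 := by
        rcases hk'.2 with h | h
        · rw [h, Real.sin_zero]
        · rw [h, Real.sin_neg, Real.sin_pi, neg_zero]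
      simp only [Pi.zero_apply]
      rw [norm_gradient_anisoBand, hsin]
      simp
    · -- `a ≠ 0`: the leftover is countable, hence `μH[1]`-null
      have hcount : ((fermiCurve (fun k : Momentum => -2 * (a * Real.cos (k 0) + b * Real.cos (k 1))) μ \ Bp) \
          Bm).Countable := by
        refine Set.Countable.mono (fermiCurve_anisoBand_diff_subset a b μ) ?_
        have hC : ({x : ℝ | Real.cos x = (-μ / 2 - b) / a} ∪ {x : ℝ | Real.cos x = (-μ / 2 + b) / a}).Countable :=
          (countable_setOf_cos_eq _).union (countable_setOf_cos_eq _)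
        have hY : ({0, -π} : Set ℝ).Countable := (Set.toFinite _).countable
        refine ((hC.prod hY).image (fun p : ℝ × ℝ => (WithLp.toLp 2 ![p.1, p.2] : Momentum))).mono ?_
        rintro k ⟨hkF, hk1⟩
        have hlev : -2 * (a * Real.cos (k 0) + b * Real.cos (k 1)) = μ := hkF.2
        refine ⟨(k 0, k 1), ⟨?_, ?_⟩, ?_⟩
        · rcases hk1 with h | h
          · left
            simp only [mem_setOf_eq]
            rw [h, Real.cos_zero] at hlev
            field_simp
            linarith
          · right
            simp only [mem_setOf_eq]
            rw [h, Real.cos_neg, Real.cos_pi] at hlev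
            field_simp
            linarith
        · rcases hk1 with h | h <;> simp [h]
        · ext i; fin_cases i <;> simp
      haveI := nullSingletonClass_hausdorff Momentum (one_pos : (0 : ℝ) < 1)
      exact setLIntegral_measure_zero _ _ (hcount.measure_zero _)
  -- the second piece after removing the first
  have hdisj : (fermiCurve (fun k : Momentum => -2 * (a * Real.cos (k 0) + b * Real.cos (k 1))) μ \ Bp) ∩ Bm =
      fermiCurve (fun k : Momentum => -2 * (a * Real.cos (k 0) + b * Real.cos (k 1))) μ ∩ Bm := by
    ext k
    simp only [mem_inter_iff, mem_sdiff, hBp, hBm, mem_setOf_eq, mem_Ioo, one_mul, neg_one_mul]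
    constructor
    · rintro ⟨⟨hF, -⟩, h⟩; exact ⟨hF, h⟩
    · rintro ⟨hF, h⟩
      refine ⟨⟨hF, ?_⟩, h⟩
      rintro ⟨h1, -⟩
      linarith [h.1]
  -- assemble the left-hand side
  have hLHS : fermiCurveMeasure (fun k : Momentum => -2 * (a * Real.cos (k 0) + b * Real.cos (k 1))) μ univ =
      2 * ∫⁻ x in T, ENNReal.ofReal (1 / Real.sqrt (4 * b ^ 2 - (μ + 2 * a * Real.cos x) ^ 2)) := by
    rw [h0, ← lintegral_inter_add_sdiff _ _ hBpm, ← lintegral_inter_add_sdiff _ (_ \ Bp) hBmm, hdisj,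
      hBp, hBm, hP 1 (Or.inl rfl), hP (-1) (Or.inr rfl), ← hBp, ← hBm, hL, add_zero, ← two_mul]
  -- the right-hand side
  have hN : Measurable fun x : ℝ => ENNReal.ofReal (1 / Real.sqrt (4 * b ^ 2 - (μ + 2 * a * Real.cos x) ^ 2)) :=
    (by fun_prop : Measurable fun x : ℝ => 1 / Real.sqrt (4 * b ^ 2 - (μ + 2 * a * Real.cos x) ^ 2)).ennreal_ofReal
  have hRHS : ∫⁻ x in Ico (-π) π, ENNReal.ofReal (2 / Real.sqrt (4 * b ^ 2 - (μ + 2 * a * Real.cos x) ^ 2)) =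
      2 * ∫⁻ x in T, ENNReal.ofReal (1 / Real.sqrt (4 * b ^ 2 - (μ + 2 * a * Real.cos x) ^ 2)) := by
    rw [← lintegral_inter_add_sdiff _ (Ico (-π) π) hUo.measurableSet]
    have hz : ∫⁻ x in Ico (-π) π \ U, ENNReal.ofReal (2 / Real.sqrt (4 * b ^ 2 - (μ + 2 * a * Real.cos x) ^ 2)) = 0 := by
      refine setLIntegral_eq_zero (measurableSet_Ico.diff hUo.measurableSet) fun x hx => ?_
      have hx' : ¬ (-(μ + 2 * a * Real.cos x) / (2 * b) ∈ Ioo (-1 : ℝ) 1) := hx.2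
      set h : ℝ := -(μ + 2 * a * Real.cos x) / (2 * b) with hh
      have hD : 4 * b ^ 2 - (μ + 2 * a * Real.cos x) ^ 2 = 4 * b ^ 2 * (1 - h ^ 2) := by
        rw [hh]; field_simp; ring
      have habs : 1 ≤ |h| := by
        by_contra hc
        exact hx' (abs_lt.1 (lt_of_not_ge hc))
      have hsq : 1 ≤ h ^ 2 := by
        have h1 : 1 ≤ |h| * |h| := by nlinarith [abs_nonneg h]
        rw [abs_mul_abs_self] at h1
        nlinarith [h1]
      have hle : 4 * b ^ 2 - (μ + 2 * a * Real.cos x) ^ 2 ≤ 0 := by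
        rw [hD]; nlinarith [sq_nonneg b]
      simp only [Pi.zero_apply]
      rw [Real.sqrt_eq_zero'.2 hle, div_zero, ENNReal.ofReal_zero]
    rw [hz, add_zero]
    have h2 : ∀ x ∈ T, ENNReal.ofReal (2 / Real.sqrt (4 * b ^ 2 - (μ + 2 * a * Real.cos x) ^ 2)) =
        ENNReal.ofReal (1 / Real.sqrt (4 * b ^ 2 - (μ + 2 * a * Real.cos x) ^ 2)) +
          ENNReal.ofReal (1 / Real.sqrt (4 * b ^ 2 - (μ + 2 * a * Real.cos x) ^ 2)) := fun x _ => by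
      rw [← ENNReal.ofReal_add (by positivity) (by positivity)]
      congr 1
      ring
    rw [setLIntegral_congr_fun hTm h2, lintegral_add_left hN, ← two_mul]
  rw [hLHS, hRHS]

end Literature.MathematicalPhysics.QuantumLattice

end
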